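import Literature.MathematicalPhysics.QuantumFieldTheory.Balaban1983to89.B1Ineq326HiggsModel

/-!
# `Balaban1983to89.B1Ineq368BoxBound` — T. Bałaban, *(Higgs)₂,₃ quantum fields in a finite volume. I. A lower bound*,
Commun. Math. Phys. **85** (1982) 603–626 [Balaban1982Higgs1]: the step **(3.67) ⇒ (3.68)** p. 625 — *"The quatratic
forms in the exponential above are bounded, so the integral can be estimated from below by exp(−O(1)|T_ε|) with a
constant O(1) which in general depends on L^Kε, thus on ε₀. We get Z^ε ≧ Z_KZ_K(0) exp(−E₀ + O(1)|T_ε|). (3.68)"* — PROVED: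
schematically (the Gaussian integral of (3.67) over the small-field set is at least its volume times the infimum of the
integrand) and CONCRETELY for the (Higgs)₂,₃ model (the small-field set of (3.67) `{|A(x)| ≦ r, |φ(x)| ≦ r ∀x}` in the
configuration space `(bonds → ℝ) × (sites → ℝ^N)` of `T^{(K)}_{L^Kε}` has Lebesgue volume EXACTLY
`(r^dω_d)^{|T^{(K)}|}(r^Nω_N)^{|T^{(K)}|}`, `ω_n` the volume of the unit ball of `ℝ^n`, and `|T^{(K)}|(L^Kε)^d = |T_ε|`), whence
the FIRST CONJUNCT of r12's typed (3.68)–(3.69) `B1Sect3Statements.Ineq368` for the model, given the (3.26) induction inputs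
(`B1Ineq326HiggsModel`, this seat) and the displayed expansion inputs of pp. 624–625

statement-level skeleton of published theorems with citation tags; proofs where landed; nothing here is a claim about the Yang–Mills mass gap

PDF held: `paper:balaban1982-cmp85-higgs23-i` (journal page = PDF page + 602); p. 625 READ AS IMAGE on the ×2 render
`run/shared/lean/pub/pub-balaban/b2b-balaban-ref1/pages/1982-cmp85-higgs23-I/…-p023-x2.png`; (3.26) p. 617, (1.2)/(1.21) pp. 604/607.

CITATION HEADER (lean-in-tree rule).  lit-balaban typed skeleton (HOME `run/shared/lean/pub/lit-balaban/`), SKELETON row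
**B1.Eq3.68–3.69** (owner r12; coarse row B1.Eq3.68, r01/r14): typed p239973 as `B1Sect3Statements.Ineq368 Z Z_K Z_K(0) E₀ C₁ C₂
|T_ε|` = (3.68) ∧ (3.69) with two explicit `O(1)`'s, + `lowerBound_of_368`; the (3.69) conjunct PROVED by p12
(`B1Eq369GaussRatio.ineq368_right`, p247512/p247808/p247902) and p04 (`B1Eq346DetFactorization` §6); the uniform assembly
(1.14) from `Ineq368` by r14 (`B1Eq368LowerAssembly`, p252119); (3.26)_K ⇒ (3.66) ⇒ (3.67) by this seat (`B1Ineq367Proof`,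
p245393; model instance `B1Ineq326HiggsModel.ineq367_model`, p252399).  THE MEMBER (3.67) ⇒ (3.68) — the sentence quoted in
the title — had no declaration; this file supplies it, so that the (3.68) CONJUNCT of `Ineq368` is now DERIVED from (3.67).

THE MATHEMATICS OF THE SENTENCE.  (3.67) reads `Z^ε ≧ e^{−O₁|T_ε|}·∫dA∫dφ 𝟙_S(A,φ)·Z_KZ_K(0)·exp(−½⟨A,Δ^{(K)}A⟩ −
½⟨φ,Δ^{(K)}(0)φ⟩ − E₀)` with `S = {|A(x)| ≦ r, |φ(x)| ≦ r for all x ∈ T^{(K)}_{L^Kε}}`, `r = c₁⁻¹(L^Kε)^{−(d−2)/2}p(L^Kε)`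
(`B1Ineq367Proof.ineq367_O1`: `O₁ = C₁ + C₂ + C·ε₀^{κ₀}/(L^{κ₀} − 1)`).  On `S` the two (non-negative) quadratic forms are
bounded, `0 ≦ ½⟨A,Δ^{(K)}A⟩ + ½⟨φ,Δ^{(K)}(0)φ⟩ ≦ Q`, so the integral is `≧ Z_KZ_K(0)e^{−E₀}·e^{−Q}·vol(S)`; and `vol(S) =
(r^dω_d·r^Nω_N)^{|T^{(K)}|}` with `|T^{(K)}| = (L^Kε)^{−d}|T_ε|` sites, i.e. `vol(S) ≧ exp(−C₄|T_ε|)` with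
`C₄ = (L^Kε)^{−d}·max{0, −log(r^{d+N}ω_dω_N)}` and `Q = C₅|T_ε|` — constants depending on `L^Kε ∈ (ε₀/L, ε₀]`, *"thus on ε₀"*.
Hence (3.68): `Z^ε ≧ Z_KZ_K(0)·exp(−E₀ − (O₁ + C₄ + C₅)|T_ε|)`.

WHAT THIS FILE PROVES (0 `sorry`; standard axioms).
* §1 (schematic, one measure space `(Ω, μ)` ↤ `dA dφ` on `T^{(K)}` as in `B1Ineq367Proof`): `indicator_integral_ge` (an
  integral over a set of finite measure is at least the measure times a lower bound of the integrand); **`ineq368_of_367`** —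
  (3.67) [the conclusion shape of `ineq367_O1`, `χsm = 𝟙_S`] + `½qA + ½qφ0 ≦ Q` on `S` + `μ(S)·e^{−Q} ≧ e^{−C₄|T_ε|}` ⇒
  `Z ≧ Z_KZ_K(0)·exp(−E₀ − (O₁ + C₄)|T_ε|)`; `integrableOn_of_forms_nonneg` (the integrability input from `0 ≦` forms);
  `ineq368_of_conjuncts` + `lowerBound_of_367_369` (with the (3.69) conjunct: r12's `Ineq368` and `lowerBound_of_368` BY NAME
  ⇒ `Z^ε ≧ exp(−(C₁ + C₂)|T_ε|)`, *"and we obtain finally the required lower bound"*).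
* §2 (CONCRETE, the typer's carriers): `smallSet` (the set `S` of (3.67) in `VecField P K × ScalarField P K N`),
  `smallSet_eq_prod`, `measurableSet_smallSet`, `unitBallVol` (`ω_n`), **`volume_smallSet`** (EXACT volume, via the p. 608
  device `HiggsDoubleRT.measurePreserving_toSiteEquiv` and `Measure.addHaar_closedBall'`), `volume_smallSet_ne_top`,
  `card_site`/`vol_univ_eq` (`|T^{(k)}_{L^kε}|(L^kε)^d = |T_ε|` for `k ≦ K` of (1.2)), `boxConst`/`boxConst_nonneg`,
  **`exp_neg_boxConst_le`** (`exp(−C₄|T_ε|) ≦ vol(S_r)`).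
* §3 **`ineq368_model`** — (3.68) FOR THE (Higgs)₂,₃ MODEL: `B1Ineq326HiggsModel.ineq367_model` (the (3.26) induction for the
  model + (E1), (E2) of pp. 624–625) at `χsm = 𝟙_{S_r}`, + (E3) `χ_K = 1 on S_r` (*"the configuration … is regular on the basis
  of the restrictions"*, Props. 2.2/2.3), + the displayed bound `0 ≦ ½qA + ½qφ0 ≦ C₅|T_ε|` on `S_r`, + §1–§2 ⇒
  `∫dAdφ e^{−S^{(0)}} ≧ Z_KZ_K(0)·exp(−E₀ − (C₁ + C₂ + C·ε₀^{κ₀}/(L^{κ₀}−1) + C₄ + C₅)|T_ε|)`; `lowerBound_model` (+ the (3.69)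
  conjunct ⇒ `Z^ε ≧ exp(−E₋|T_ε|)` at this cutoff, `E₋` explicit).
HONEST SCOPE.  Displayed, not proved: the (3.26) step inputs `h360` (Props. 3.1/3.2, (3.59), [III]), (E1)–(E3), the bound on
the quadratic forms (`‖Δ^{(K)}‖·r²·|T^{(K)}|`-type arithmetic once the operators are fixed — the forms are arguments here, as
in `B1Ineq367Proof`), the (3.69) conjunct (p12's file proves it for its matrix carriers); one cutoff at a time, constants
explicit.  Unit `lit-balaban-p14` gen 7 (literature-prover-lit-balaban-p14-g7-0), HOME `run/shared/lean/pub/lit-balaban/`.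
-/

open scoped BigOperators
open _root_.MeasureTheory

namespace Literature.MathematicalPhysics.QuantumFieldTheory.Balaban1983to89.B1Ineq368BoxBound

open Literature.MathematicalPhysics.QuantumFieldTheory.Balaban1983to89
open Literature.MathematicalPhysics.QuantumFieldTheory.Balaban1983to89.HiggsLattice
open Literature.MathematicalPhysics.QuantumFieldTheory.Balaban1983to89.HiggsDoubleRT
open Literature.MathematicalPhysics.QuantumFieldTheory.Balaban1983to89.B3MultiscaleFields (toSite)
open Literature.MathematicalPhysics.QuantumFieldTheory.Balaban1983to89.B1Sect3Statements (Ineq368 lowerBound_of_368)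
open Literature.MathematicalPhysics.QuantumFieldTheory.Balaban1983to89.B1Ineq326HiggsModel (chiW extW chiW_mem_Icc ineq367_model)
open Finset (range)
open Metric

/-! ## 1. The schematic step: an integral over the small-field set is at least volume × infimum -/

section Schematic

variable {Ω : Type*} [MeasurableSpace Ω] (μ : Measure Ω)

/-- The integral of `𝟙_S·f` is at least `c·μ(S)` when `f ≧ c` on the set `S` of finite measure (`f` integrable on `S`) —
*"so the integral can be estimated from below by …"*. [cite: Balaban1982Higgs1, (3.68) p.625] -/
theorem indicator_integral_ge {S : Set Ω} (hS : MeasurableSet S) (hμS : μ S ≠ ⊤) {f : Ω → ℝ} {c : ℝ}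
    (hf : ∀ ω ∈ S, c ≤ f ω) (hint : IntegrableOn f S μ) :
    c * μ.real S ≤ ∫ ω, S.indicator f ω ∂μ := by
  rw [integral_indicator hS]
  exact setIntegral_ge_of_const_le_real hS hμS hf hint

/-- The integrability input of `ineq368_of_367` from the printed facts: the forms are `≧ 0` on `S` (the operators `Δ^{(K)}`,
`Δ^{(K)}(0)` are positive, Prop. 2.3), measurable, and `S` has finite measure — then `Z_KZ_K(0)·exp(−½qA − ½qφ0 − E₀)` is
integrable on `S`. [cite: Balaban1982Higgs1, (3.67)–(3.68) p.625] -/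
theorem integrableOn_of_forms_nonneg {S : Set Ω} (hS : MeasurableSet S) (hμS : μ S ≠ ⊤) {qA qφ0 : Ω → ℝ}
    (hqA : Measurable qA) (hqφ : Measurable qφ0) (ZK E₀ : ℝ) (h0 : ∀ ω ∈ S, 0 ≤ qA ω / 2 + qφ0 ω / 2) :
    IntegrableOn (fun ω => ZK * Real.exp (-(qA ω) / 2 - qφ0 ω / 2 - E₀)) S μ := by
  have hmeas : Measurable fun ω => ZK * Real.exp (-(qA ω) / 2 - qφ0 ω / 2 - E₀) :=
    measurable_const.mul (((hqA.neg.div_const 2).sub (hqφ.div_const 2)).sub measurable_const).exp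
  refine Integrable.mono' (integrableOn_const hμS (C := |ZK| * Real.exp (-E₀))) hmeas.aestronglyMeasurable
    (ae_restrict_of_forall_mem hS fun ω hω => ?_)
  rw [norm_mul, Real.norm_eq_abs, Real.norm_eq_abs, abs_of_pos (Real.exp_pos _)]
  refine mul_le_mul_of_nonneg_left (Real.exp_le_exp.2 ?_) (abs_nonneg _)
  have := h0 ω hω
  linarith

/-- **(3.67) ⇒ (3.68) p. 625, schematically**: if (3.67) holds in the shape delivered by `B1Ineq367Proof.ineq367_O1` —
`(∫ χsm·Z_KZ_K(0)·exp(−½qA − ½qφ0 − E₀) dμ)·e^{−O₁|T_ε|} ≦ Z^ε` with `χsm = 𝟙_S` the product of the explicit small-field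
characteristic functions of (3.67) —, if on `S` *"the quadratic forms in the exponential above are bounded"*,
`½qA + ½qφ0 ≦ Q`, and if `μ(S)·e^{−Q} ≧ e^{−C₄|T_ε|}` (the volume of the small-field box, §2), then **(3.68)**:
`Z^ε ≧ Z_KZ_K(0)·exp(−E₀ − (O₁ + C₄)|T_ε|)`. [cite: Balaban1982Higgs1, (3.68) p.625] -/
theorem ineq368_of_367 {S : Set Ω} (hS : MeasurableSet S) (hμS : μ S ≠ ⊤) {qA qφ0 χsm : Ω → ℝ}
    {Z ZK E₀ O₁ Q C₄ vol : ℝ} (hZK : 0 ≤ ZK) (hχ : ∀ ω, χsm ω = S.indicator (fun _ => (1 : ℝ)) ω)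
    (h367 : (∫ ω, χsm ω * (ZK * Real.exp (-(qA ω) / 2 - qφ0 ω / 2 - E₀)) ∂μ) * Real.exp (-(O₁ * vol)) ≤ Z)
    (hQ : ∀ ω ∈ S, qA ω / 2 + qφ0 ω / 2 ≤ Q)
    (hint : IntegrableOn (fun ω => ZK * Real.exp (-(qA ω) / 2 - qφ0 ω / 2 - E₀)) S μ)
    (hbox : Real.exp (-(C₄ * vol)) ≤ μ.real S * Real.exp (-Q)) :
    ZK * Real.exp (-E₀ - (O₁ + C₄) * vol) ≤ Z := by
  have hind : ∀ ω, χsm ω * (ZK * Real.exp (-(qA ω) / 2 - qφ0 ω / 2 - E₀))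
      = S.indicator (fun ω => ZK * Real.exp (-(qA ω) / 2 - qφ0 ω / 2 - E₀)) ω := by
    intro ω
    rw [hχ ω]
    by_cases hω : ω ∈ S
    · simp [Set.indicator_of_mem hω]
    · simp [Set.indicator_of_notMem hω]
  simp_rw [hind] at h367
  have hlow : ∀ ω ∈ S, ZK * Real.exp (-Q - E₀) ≤ ZK * Real.exp (-(qA ω) / 2 - qφ0 ω / 2 - E₀) := by
    intro ω hω
    refine mul_le_mul_of_nonneg_left (Real.exp_le_exp.2 ?_) hZK
    have := hQ ω hω
    linarith
  have hI := indicator_integral_ge μ hS hμS hlow hint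
  have hvol : 0 ≤ μ.real S := measureReal_nonneg
  calc ZK * Real.exp (-E₀ - (O₁ + C₄) * vol)
      = ZK * Real.exp (-E₀) * Real.exp (-(C₄ * vol)) * Real.exp (-(O₁ * vol)) := by
        rw [mul_assoc, mul_assoc, ← Real.exp_add, ← Real.exp_add]; ring_nf
    _ ≤ ZK * Real.exp (-E₀) * (μ.real S * Real.exp (-Q)) * Real.exp (-(O₁ * vol)) :=
        mul_le_mul_of_nonneg_right (mul_le_mul_of_nonneg_left hbox (mul_nonneg hZK (Real.exp_pos _).le))
          (Real.exp_pos _).le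
    _ = ZK * Real.exp (-Q - E₀) * μ.real S * Real.exp (-(O₁ * vol)) := by
        rw [show -Q - E₀ = -E₀ + -Q by ring, Real.exp_add]; ring
    _ ≤ (∫ ω, S.indicator (fun ω => ZK * Real.exp (-(qA ω) / 2 - qφ0 ω / 2 - E₀)) ω ∂μ)
          * Real.exp (-(O₁ * vol)) := mul_le_mul_of_nonneg_right hI (Real.exp_pos _).le
    _ ≤ Z := h367

/-- The two conjuncts assembled into r12's typed (3.68)–(3.69) `B1Sect3Statements.Ineq368` (`Z_KZ_K(0)` split as the product
of the two normalization factors). [cite: Balaban1982Higgs1, (3.68)–(3.69) p.625] -/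
theorem ineq368_of_conjuncts {Z ZK ZK0 E₀ C₁ C₂ vol : ℝ} (h368 : ZK * ZK0 * Real.exp (-E₀ - C₁ * vol) ≤ Z)
    (h369 : Real.exp (-C₂ * vol) ≤ ZK * ZK0 * Real.exp (-E₀)) : Ineq368 Z ZK ZK0 E₀ C₁ C₂ vol :=
  ⟨h368, h369⟩

/-- *"and we obtain finally the required lower bound"* (p. 625): (3.67) in the `ineq367_O1` shape with `Z_KZ_K(0) = ZK·ZK0`,
the bounded forms, the box volume, and the (3.69) conjunct `Z_KZ_K(0)e^{−E₀} ≧ e^{−C₂|T_ε|}` give `Z^ε ≧ exp(−(O₁ + C₄ + C₂)|T_ε|)`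
— r12's `lowerBound_of_368` applied to `ineq368_of_367`. [cite: Balaban1982Higgs1, (3.68)–(3.69) p.625] -/
theorem lowerBound_of_367_369 {S : Set Ω} (hS : MeasurableSet S) (hμS : μ S ≠ ⊤) {qA qφ0 χsm : Ω → ℝ}
    {Z ZK ZK0 E₀ O₁ Q C₄ C₂ vol : ℝ} (hZK : 0 ≤ ZK) (hZK0 : 0 ≤ ZK0)
    (hχ : ∀ ω, χsm ω = S.indicator (fun _ => (1 : ℝ)) ω)
    (h367 : (∫ ω, χsm ω * (ZK * ZK0 * Real.exp (-(qA ω) / 2 - qφ0 ω / 2 - E₀)) ∂μ) * Real.exp (-(O₁ * vol)) ≤ Z)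
    (hQ : ∀ ω ∈ S, qA ω / 2 + qφ0 ω / 2 ≤ Q)
    (hint : IntegrableOn (fun ω => ZK * ZK0 * Real.exp (-(qA ω) / 2 - qφ0 ω / 2 - E₀)) S μ)
    (hbox : Real.exp (-(C₄ * vol)) ≤ μ.real S * Real.exp (-Q))
    (h369 : Real.exp (-C₂ * vol) ≤ ZK * ZK0 * Real.exp (-E₀)) :
    Real.exp (-(O₁ + C₄ + C₂) * vol) ≤ Z := by
  have h368 := ineq368_of_367 μ hS hμS (mul_nonneg hZK hZK0) hχ h367 hQ hint hbox
  exact lowerBound_of_368 (ineq368_of_conjuncts h368 h369)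

end Schematic

/-! ## 2. The small-field set of (3.67) in the model's configuration space and its volume -/

section Concrete

variable {P : Params} {N : ℕ}

/-- **The small-field set of (3.67) p. 625**: `S_r = {(A, φ) : |A(x)| ≦ r and |φ(x)| ≦ r for every x ∈ T^{(K)}_{L^Kε}}`
(`|A(x)|` the Euclidean norm of `(A_μ(x))_μ ∈ ℝ^d`, p. 608; `|φ(x)|` that of `ℝ^N`; printed `r = c₁⁻¹(L^Kε)^{−(d−2)/2}p(L^Kε)`),
whose characteristic function `Π_x χ(…)χ(…)` the display carries. [cite: Balaban1982Higgs1, (3.67) p.625] -/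
def smallSet (P : Params) (N K : ℕ) (r : ℝ) : Set (VecField P K × ScalarField P K N) :=
  {Φ | (∀ x, ‖toSite Φ.1 x‖ ≤ r) ∧ ∀ x, ‖Φ.2 x‖ ≤ r}

/-- `S_r` is the product of two products of closed balls, the vector-field factor read through the p. 608 device
`A ↦ (x ↦ (A_μ(x))_μ)`. [cite: Balaban1982Higgs1, (3.67) p.625] -/
theorem smallSet_eq_prod (K : ℕ) (r : ℝ) :
    smallSet P N K r
      = ((toSiteEquiv P K) ⁻¹' Set.pi Set.univ fun _ : Site P K => closedBall (0 : EuclideanSpace ℝ (Fin P.d)) r)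
          ×ˢ Set.pi Set.univ fun _ : Site P K => closedBall (0 : EuclideanSpace ℝ (Fin N)) r := by
  ext Φ
  simp only [smallSet, Set.mem_setOf_eq, Set.mem_prod, Set.mem_preimage, Set.mem_univ_pi, mem_closedBall,
    dist_zero_right, coe_toSiteEquiv]

/-- `S_r` is measurable. [cite: Balaban1982Higgs1, (3.67) p.625] -/
theorem measurableSet_smallSet (K : ℕ) (r : ℝ) : MeasurableSet (smallSet P N K r) := by
  rw [smallSet_eq_prod]
  exact ((MeasurableSet.univ_pi fun _ => measurableSet_closedBall).preimage (toSiteEquiv P K).measurable).prod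
    (MeasurableSet.univ_pi fun _ => measurableSet_closedBall)

/-- `ω_n`: the Lebesgue volume of the unit ball of `ℝ^n`. [cite: Balaban1982Higgs1, (3.68) p.625] -/
noncomputable def unitBallVol (n : ℕ) : ℝ :=
  (volume : Measure (EuclideanSpace ℝ (Fin n))).real (closedBall 0 1)

/-- `ω_n > 0`. [cite: Balaban1982Higgs1, (3.68) p.625] -/
theorem unitBallVol_pos (n : ℕ) : 0 < unitBallVol n :=
  ENNReal.toReal_pos (measure_closedBall_pos volume _ zero_lt_one).ne' measure_closedBall_lt_top.ne

/-- The volume of the closed ball of radius `r ≧ 0` in `ℝ^n` is `r^n·ω_n` (as an extended real). [cite: Balaban1982Higgs1, (3.68) p.625] -/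
theorem volume_closedBall_fin (n : ℕ) {r : ℝ} (hr : 0 ≤ r) :
    volume (closedBall (0 : EuclideanSpace ℝ (Fin n)) r) = ENNReal.ofReal (r ^ n * unitBallVol n) := by
  rw [Measure.addHaar_closedBall' volume (0 : EuclideanSpace ℝ (Fin n)) hr, finrank_euclideanSpace_fin, unitBallVol,
    measureReal_def, ENNReal.ofReal_mul (pow_nonneg hr n), ENNReal.ofReal_toReal measure_closedBall_lt_top.ne]

/-- A product over the sites of closed balls of `ℝ^n` has volume `(r^nω_n)^{|T^{(K)}|}`. [cite: Balaban1982Higgs1, (3.68) p.625] -/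
theorem volume_pi_closedBall (K n : ℕ) {r : ℝ} (hr : 0 ≤ r) :
    volume (Set.pi Set.univ fun _ : Site P K => closedBall (0 : EuclideanSpace ℝ (Fin n)) r)
      = ENNReal.ofReal ((r ^ n * unitBallVol n) ^ Fintype.card (Site P K)) := by
  rw [volume_pi_pi, Finset.prod_const, Finset.card_univ, volume_closedBall_fin n hr,
    ENNReal.ofReal_pow (mul_nonneg (pow_nonneg hr n) (unitBallVol_pos n).le)]

/-- **The volume of the small-field set of (3.67)**, EXACTLY: `vol(S_r) = (r^dω_d)^{|T^{(K)}|}·(r^Nω_N)^{|T^{(K)}|}` for `r ≧ 0`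
(Lebesgue measure `dA dφ` on `(bonds → ℝ) × (sites → ℝ^N)`; the change of variables `dA ↔` Lebesgue on `ℝ^d`-valued site
functions is `HiggsDoubleRT.measurePreserving_toSiteEquiv`). [cite: Balaban1982Higgs1, (3.68) p.625] -/
theorem volume_smallSet (K : ℕ) {r : ℝ} (hr : 0 ≤ r) :
    volume (smallSet P N K r)
      = ENNReal.ofReal (((r ^ P.d * unitBallVol P.d) ^ Fintype.card (Site P K))
          * ((r ^ N * unitBallVol N) ^ Fintype.card (Site P K))) := by
  rw [smallSet_eq_prod, Measure.volume_eq_prod, Measure.prod_prod,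
    (measurePreserving_toSiteEquiv (P := P) (k := K)).measure_preimage_equiv, volume_pi_closedBall K P.d hr,
    volume_pi_closedBall K N hr, ← ENNReal.ofReal_mul (pow_nonneg (mul_nonneg (pow_nonneg hr _) (unitBallVol_pos _).le) _)]

/-- `vol(S_r) < ∞`. [cite: Balaban1982Higgs1, (3.68) p.625] -/
theorem volume_smallSet_ne_top (K : ℕ) {r : ℝ} (hr : 0 ≤ r) : volume (smallSet P N K r) ≠ ⊤ := by
  rw [volume_smallSet K hr]
  exact ENNReal.ofReal_ne_top

/-- `vol(S_r)` as a real number. [cite: Balaban1982Higgs1, (3.68) p.625] -/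
theorem volume_real_smallSet (K : ℕ) {r : ℝ} (hr : 0 ≤ r) :
    (volume : Measure (VecField P K × ScalarField P K N)).real (smallSet P N K r)
      = ((r ^ P.d * unitBallVol P.d) ^ Fintype.card (Site P K)) * ((r ^ N * unitBallVol N) ^ Fintype.card (Site P K)) := by
  rw [measureReal_def, volume_smallSet K hr, ENNReal.toReal_ofReal]
  exact mul_nonneg (pow_nonneg (mul_nonneg (pow_nonneg hr _) (unitBallVol_pos _).le) _)
    (pow_nonneg (mul_nonneg (pow_nonneg hr _) (unitBallVol_pos _).le) _)

/-- The number of sites of `T^{(k)}_{L^kε}`: `|T^{(k)}| = Π_μ 2L^{K−k}ML′_μ` ((1.2) p. 604 with (1.19)–(1.20) p. 607).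
[cite: Balaban1982Higgs1, (1.20) p.607] -/
theorem card_site (P : Params) (k : ℕ) : Fintype.card (Site P k) = ∏ μ : Fin P.d, P.sitesPerDir k μ := by
  have h : Fintype.card (Site P k) = Fintype.card ((μ : Fin P.d) → ZMod (P.sitesPerDir k μ)) :=
    Fintype.card_congr (Equiv.refl _)
  rw [h, Fintype.card_pi]
  exact Finset.prod_congr rfl fun μ _ => ZMod.card _

/-- `|T_ε| = L^{kd}·|T^{(k)}_{L^kε}|` for `k ≦ K` (each of the `d` directions carries `2L^KML′_μ = L^k·2L^{K−k}ML′_μ` sites).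
[cite: Balaban1982Higgs1, (1.20) p.607] -/
theorem card_site_zero_eq {k : ℕ} (hk : k ≤ P.K) :
    Fintype.card (Site P 0) = P.L ^ (k * P.d) * Fintype.card (Site P k) := by
  rw [card_site, card_site]
  have hK : P.L ^ P.K = P.L ^ k * P.L ^ (P.K - k) := by rw [← pow_add, Nat.add_sub_cancel' hk]
  have h : ∀ μ : Fin P.d, P.sitesPerDir 0 μ = P.L ^ k * P.sitesPerDir k μ := by
    intro μ
    unfold Params.sitesPerDir
    rw [Nat.sub_zero, hK]
    ring
  rw [Finset.prod_congr rfl fun μ _ => h μ, Finset.prod_mul_distrib, Finset.prod_const, Finset.card_univ,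
    Fintype.card_fin, ← pow_mul]

/-- **`|T^{(k)}_{L^kε}|·(L^kε)^d = |T_ε|`** for `k ≦ K`: the tori `T^{(k)}_{L^kε} = T_ε ∩ L^kεℤ^d` all have the volume
`|T_ε| = Σ_{x∈T_ε}ε^d = Π_μ 2L_μ` ((1.2), (1.21) p. 607) — `P.vol k univ = P.vol 0 univ`. [cite: Balaban1982Higgs1, (1.21) p.607] -/
theorem vol_univ_eq {k : ℕ} (hk : k ≤ P.K) : P.vol k Finset.univ = P.vol 0 Finset.univ := by
  unfold Params.vol
  rw [Finset.card_univ, Finset.card_univ, card_site_zero_eq hk]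
  unfold Params.mesh
  push_cast
  ring

/-- **The constant `C₄` of the box volume** — `exp(−C₄|T_ε|) ≦ vol(S_r)`: `C₄ = (L^Kε)^{−d}·max{0, −log(r^dω_d·r^Nω_N)}`,
a constant which *"in general depends on L^Kε, thus on ε₀"* (p. 625). [cite: Balaban1982Higgs1, (3.68) p.625] -/
noncomputable def boxConst (P : Params) (N K : ℕ) (r : ℝ) : ℝ :=
  (P.mesh K ^ P.d)⁻¹ * max 0 (-Real.log ((r ^ P.d * unitBallVol P.d) * (r ^ N * unitBallVol N)))

/-- `C₄ ≧ 0`. [cite: Balaban1982Higgs1, (3.68) p.625] -/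
theorem boxConst_nonneg (P : Params) (N K : ℕ) (r : ℝ) : 0 ≤ boxConst P N K r :=
  mul_nonneg (inv_nonneg.2 (pow_nonneg (P.mesh_pos K).le _)) (le_max_left _ _)

/-- **The volume of the small-field set is at least `exp(−C₄|T_ε|)`** for `r > 0` and `K ≦` the `K` of (1.2) (so that
`|T^{(K)}|(L^Kε)^d = |T_ε|`): `vol(S_r) = exp(|T^{(K)}|·log(r^dω_d·r^Nω_N)) ≧ exp(−C₄|T_ε|)`. [cite: Balaban1982Higgs1, (3.68) p.625] -/
theorem exp_neg_boxConst_le {K : ℕ} (hK : K ≤ P.K) {r : ℝ} (hr : 0 < r) :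
    Real.exp (-(boxConst P N K r * P.vol 0 Finset.univ))
      ≤ (volume : Measure (VecField P K × ScalarField P K N)).real (smallSet P N K r) := by
  set x : ℝ := (r ^ P.d * unitBallVol P.d) * (r ^ N * unitBallVol N) with hx
  have hxpos : 0 < x := mul_pos (mul_pos (pow_pos hr _) (unitBallVol_pos _)) (mul_pos (pow_pos hr _) (unitBallVol_pos _))
  set n : ℕ := Fintype.card (Site P K) with hn
  have hvol : (volume : Measure (VecField P K × ScalarField P K N)).real (smallSet P N K r) = Real.exp (n * Real.log x) := by
    rw [volume_real_smallSet K hr.le, ← mul_pow, ← hx, Real.exp_nat_mul, Real.exp_log hxpos]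
  have hT : P.vol 0 Finset.univ = P.mesh K ^ P.d * n := by
    rw [← vol_univ_eq hK]
    unfold Params.vol
    rw [Finset.card_univ]
  have hmesh : 0 < P.mesh K ^ P.d := pow_pos (P.mesh_pos K) _
  rw [hvol, Real.exp_le_exp, hT, boxConst, ← hx]
  have h1 : (P.mesh K ^ P.d)⁻¹ * max 0 (-Real.log x) * (P.mesh K ^ P.d * (n : ℝ)) = max 0 (-Real.log x) * n := by
    field_simp
  rw [h1]
  have h2 : -max 0 (-Real.log x) ≤ Real.log x := by
    rcases le_total 0 (-Real.log x) with h | h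
    · rw [max_eq_right h]; linarith
    · rw [max_eq_left h]; linarith
  nlinarith [h2, (Nat.cast_nonneg n : (0 : ℝ) ≤ n)]

end Concrete

/-! ## 3. (3.68) for the (Higgs)₂,₃ model -/

section Model

variable {P : Params} {N : ℕ} (C : ChargeData N) (ℓ p : ℕ → ℝ) (mu0sq : ℝ) {msq a : ℝ}

/-- **(3.68) p. 625 FOR THE (Higgs)₂,₃ MODEL**: for `a > 0`, `m² > 0`, `L > 1`, `K ≦` the `K` of (1.2) with `L^Kε ≦ ε₀`,
actions `S^{(k)}` with `exp(−S^{(k)}) ∈ L¹`, the (3.26) step inputs `h360` at the levels `k < K` (pp. 619–623), the expansion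
inputs of pp. 624–625 on the support of `χ_K` — (E1) `Z_KZ_K(0)·exp(−½qA − ½qφ0 + V − E₀ − C₁|T_ε|) ≦ exp(−S^{(K)})` (Prop. 3.1),
(E2) `|V^{(K)}| ≦ C₂|T_ε|` (Prop. 3.2) —, (E3) `χ_K = 1` on the small-field set `S_r` (regularity of the background fields,
Props. 2.2/2.3), measurable forms with `0 ≦ ½qA + ½qφ0 ≦ C₅|T_ε|` on `S_r` (*"the quadratic forms in the exponential above
are bounded"*), `r > 0` (printed `c₁⁻¹(L^Kε)^{−(d−2)/2}p(L^Kε)`): `∫dA∫dφ exp(−S^{(0)}) ≧ Z_KZ_K(0)·exp(−E₀ − (C₁ + C₂ +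
C·ε₀^{κ₀}/(L^{κ₀} − 1) + C₄ + C₅)|T_ε|)` — `B1Ineq326HiggsModel.ineq367_model` at `χsm = 𝟙_{S_r}` followed by `ineq368_of_367`
with the box volume `exp_neg_boxConst_le`. [cite: Balaban1982Higgs1, (3.68) p.625; (3.67) p.625; (3.26) p.617] -/
theorem ineq368_model (ha : 0 < a) (hmsq : 0 < msq) (hL : 1 < (P.L : ℝ)) {K : ℕ} (hKP : K ≤ P.K)
    (S : (k : ℕ) → VecField P k → ScalarField P k N → ℝ)
    (hS : ∀ k, k ≤ K → Integrable fun Φ : VecField P k × ScalarField P k N => Real.exp (-S k Φ.1 Φ.2))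
    {Cst κ₀ ε₀ : ℝ} (hC : 0 ≤ Cst) (hκ₀ : 0 < κ₀) (hK : P.mesh K ≤ ε₀)
    (h360 : ∀ k, k < K → ∀ (B : VecField P (k + 1)) (ψ : ScalarField P (k + 1) N),
      chiW C ℓ p mu0sq msq a (k + 1) B ψ ≠ 0 →
        Real.exp (-S (k + 1) B ψ) * Real.exp (-(Cst * P.mesh k ^ κ₀ * P.vol 0 Finset.univ))
          ≤ doubleRTk C a (extW mu0sq a k) (fun A φ => chiW C ℓ p mu0sq msq a k A φ * Real.exp (-S k A φ)) B ψ)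
    {qA qφ0 V : VecField P K × ScalarField P K N → ℝ} (hqAm : Measurable qA) (hqφm : Measurable qφ0)
    {ZK E₀ C₁ C₂ C₅ r : ℝ} (hZK : 0 ≤ ZK) (hr : 0 < r)
    (hE1 : ∀ ω : VecField P K × ScalarField P K N, chiW C ℓ p mu0sq msq a K ω.1 ω.2 ≠ 0 →
      ZK * Real.exp (-(qA ω) / 2 - qφ0 ω / 2 + V ω - E₀ - C₁ * P.vol 0 Finset.univ) ≤ Real.exp (-S K ω.1 ω.2))
    (hE2 : ∀ ω : VecField P K × ScalarField P K N, chiW C ℓ p mu0sq msq a K ω.1 ω.2 ≠ 0 →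
      |V ω| ≤ C₂ * P.vol 0 Finset.univ)
    (hE3 : ∀ ω ∈ smallSet P N K r, chiW C ℓ p mu0sq msq a K ω.1 ω.2 = 1)
    (hQ : ∀ ω ∈ smallSet P N K r, 0 ≤ qA ω / 2 + qφ0 ω / 2 ∧ qA ω / 2 + qφ0 ω / 2 ≤ C₅ * P.vol 0 Finset.univ) :
    ZK * Real.exp (-E₀ - (C₁ + C₂ + Cst * (ε₀ ^ κ₀ / ((P.L : ℝ) ^ κ₀ - 1)) + boxConst P N K r + C₅) * P.vol 0 Finset.univ)
      ≤ ∫ Φ : VecField P 0 × ScalarField P 0 N, Real.exp (-S 0 Φ.1 Φ.2) := by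
  set Sr := smallSet P N K r with hSr
  have hSm : MeasurableSet Sr := measurableSet_smallSet K r
  have hSfin : volume Sr ≠ ⊤ := volume_smallSet_ne_top K hr.le
  -- (E3): `𝟙_{S_r} ≤ χ_K(A)χ_K(φ)`
  have hE3' : ∀ ω : VecField P K × ScalarField P K N,
      Sr.indicator (fun _ => (1 : ℝ)) ω ≤ chiW C ℓ p mu0sq msq a K ω.1 ω.2 := by
    intro ω
    by_cases hω : ω ∈ Sr
    · rw [Set.indicator_of_mem hω, hE3 ω hω]
    · rw [Set.indicator_of_notMem hω]
      exact (chiW_mem_Icc C ℓ p mu0sq msq a K ω.1 ω.2).1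
  -- (3.67) for the model at `χsm = 𝟙_{S_r}` (`B1Ineq326HiggsModel.ineq367_model`)
  have h367 := ineq367_model C ℓ p mu0sq ha hmsq hL K S hS hC hκ₀ hK h360 (χsm := Sr.indicator fun _ => (1 : ℝ)) hZK
    hE1 hE2 (fun ω => Set.indicator_nonneg (fun _ _ => zero_le_one) ω) hE3'
  -- the box volume with the bound `Q = C₅|T_ε|` of the forms carried along
  have hbox : Real.exp (-((boxConst P N K r + C₅) * P.vol 0 Finset.univ))
      ≤ (volume : Measure (VecField P K × ScalarField P K N)).real Sr * Real.exp (-(C₅ * P.vol 0 Finset.univ)) := by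
    have hb := exp_neg_boxConst_le (P := P) (N := N) hKP hr
    have e : Real.exp (-((boxConst P N K r + C₅) * P.vol 0 Finset.univ))
        = Real.exp (-(boxConst P N K r * P.vol 0 Finset.univ)) * Real.exp (-(C₅ * P.vol 0 Finset.univ)) := by
      rw [← Real.exp_add]; ring_nf
    rw [e]
    exact mul_le_mul_of_nonneg_right hb (Real.exp_pos _).le
  have h368 := ineq368_of_367 (volume : Measure (VecField P K × ScalarField P K N)) hSm hSfin hZK (fun ω => rfl) h367
    (fun ω hω => (hQ ω hω).2) (integrableOn_of_forms_nonneg volume hSm hSfin hqAm hqφm ZK E₀ fun ω hω => (hQ ω hω).1)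
    hbox
  have e : -E₀ - (C₁ + C₂ + Cst * (ε₀ ^ κ₀ / ((P.L : ℝ) ^ κ₀ - 1)) + boxConst P N K r + C₅) * P.vol 0 Finset.univ
      = -E₀ - (C₁ + C₂ + Cst * (ε₀ ^ κ₀ / ((P.L : ℝ) ^ κ₀ - 1)) + (boxConst P N K r + C₅)) * P.vol 0 Finset.univ := by
    ring
  rw [e]
  exact h368

/-- **The lower bound of Theorem (1.14) for the model at one cutoff, from (3.68) and the (3.69) conjunct**: with, in addition,
`Z_KZ_K(0)·e^{−E₀} ≧ e^{−C₆|T_ε|}` ((3.69) p. 625 — p12's `B1Eq369GaussRatio.ineq368_right` for its carriers; displayed here)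
and `S^{(0)} = S^ε` (`HiggsLattice.action C c`): `Z^ε = HiggsLattice.partitionFn P 0 N C c ≧ exp(−E₋|T_ε|)` with
`E₋ = C₁ + C₂ + C·ε₀^{κ₀}/(L^{κ₀} − 1) + C₄ + C₅ + C₆` — r12's `B1Sect3Statements.lowerBound_of_368` on `ineq368_of_conjuncts`.
(*"and we obtain finally the required lower bound"*; ε-independence of the constants is the remaining content of (1.14).)
[cite: Balaban1982Higgs1, (3.68)–(3.69) p.625; Theorem (1.14) p.606] -/
theorem lowerBound_model (ha : 0 < a) (hmsq : 0 < msq) (hL : 1 < (P.L : ℝ)) {K : ℕ} (hKP : K ≤ P.K)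
    (c : Couplings) (S : (k : ℕ) → VecField P k → ScalarField P k N → ℝ) (h0 : S 0 = action C c)
    (hS : ∀ k, k ≤ K → Integrable fun Φ : VecField P k × ScalarField P k N => Real.exp (-S k Φ.1 Φ.2))
    {Cst κ₀ ε₀ : ℝ} (hC : 0 ≤ Cst) (hκ₀ : 0 < κ₀) (hK : P.mesh K ≤ ε₀)
    (h360 : ∀ k, k < K → ∀ (B : VecField P (k + 1)) (ψ : ScalarField P (k + 1) N),
      chiW C ℓ p mu0sq msq a (k + 1) B ψ ≠ 0 →
        Real.exp (-S (k + 1) B ψ) * Real.exp (-(Cst * P.mesh k ^ κ₀ * P.vol 0 Finset.univ))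
          ≤ doubleRTk C a (extW mu0sq a k) (fun A φ => chiW C ℓ p mu0sq msq a k A φ * Real.exp (-S k A φ)) B ψ)
    {qA qφ0 V : VecField P K × ScalarField P K N → ℝ} (hqAm : Measurable qA) (hqφm : Measurable qφ0)
    {ZK ZK0 E₀ C₁ C₂ C₅ C₆ r : ℝ} (hZK : 0 ≤ ZK) (hZK0 : 0 ≤ ZK0) (hr : 0 < r)
    (hE1 : ∀ ω : VecField P K × ScalarField P K N, chiW C ℓ p mu0sq msq a K ω.1 ω.2 ≠ 0 →
      ZK * ZK0 * Real.exp (-(qA ω) / 2 - qφ0 ω / 2 + V ω - E₀ - C₁ * P.vol 0 Finset.univ) ≤ Real.exp (-S K ω.1 ω.2))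
    (hE2 : ∀ ω : VecField P K × ScalarField P K N, chiW C ℓ p mu0sq msq a K ω.1 ω.2 ≠ 0 →
      |V ω| ≤ C₂ * P.vol 0 Finset.univ)
    (hE3 : ∀ ω ∈ smallSet P N K r, chiW C ℓ p mu0sq msq a K ω.1 ω.2 = 1)
    (hQ : ∀ ω ∈ smallSet P N K r, 0 ≤ qA ω / 2 + qφ0 ω / 2 ∧ qA ω / 2 + qφ0 ω / 2 ≤ C₅ * P.vol 0 Finset.univ)
    (h369 : Real.exp (-C₆ * P.vol 0 Finset.univ) ≤ ZK * ZK0 * Real.exp (-E₀)) :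
    Real.exp (-((C₁ + C₂ + Cst * (ε₀ ^ κ₀ / ((P.L : ℝ) ^ κ₀ - 1)) + boxConst P N K r + C₅) + C₆) * P.vol 0 Finset.univ)
      ≤ partitionFn P 0 N C c := by
  have h368 := ineq368_model C ℓ p mu0sq ha hmsq hL hKP S hS hC hκ₀ hK h360 hqAm hqφm (mul_nonneg hZK hZK0) hr hE1 hE2
    hE3 hQ
  rw [HiggsActionIntegrable.partitionFn_eq, ← h0]
  exact lowerBound_of_368 (ineq368_of_conjuncts h368 h369)

end Model

end Literature.MathematicalPhysics.QuantumFieldTheory.Balaban1983to89.B1Ineq368BoxBound
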